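import Summits.ValiantsHypothesis.ValiantsHypothesis.Theorems.BarrierLeverPartitionMinorsHitByVPConeSplit

/-!
# Route BarrierLever — item `PartitionMinorsHitByVP` (stmt-ValiantsHypothesis-19717):
# «ALL MINORS OF CO-RANK ≤ c», for every constant `c`

Helper file (`--supports stmt-ValiantsHypothesis-19717`; cell valiant-natproofs, rung V4, 𝒟-side door
(c); prover seat val-np-p6 gen 7). Definition-free. Closes NO item. Companion of
`…PartitionMinorsHitByVPConeSplit` (the cone split `ConeSplit.partitionMinor_hit_of_cones`).

If `Δ ⊆ 2^[h]` is a lower set missing only `c' ≤ c` subsets, every missing set `m` has all its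
`2^{h−|m|}` supersets missing, so `|[h] ∖ m| < c`; the union of the complements of the missing sets has
`< c²` elements and its complement — a set of size `≥ h − c²` — lies inside every missing set
(`exists_cone_of_corank_le`). With cores `|A| = |B| = h − c²` on the two sides the cone split applies as
soon as `2^{c²} ≤ 2h` (`partitionMinor_hit_lowerSets_of_corank_le`, `SmallCircuits ℂ (h+h) 4`);
val-np-p1 g12's witness-agnostic lower-set reduction (`DownCompression.exists_witness_of_lowerSets`) and
truncation (`AdditiveDoor.truncation_spec`) transfer this to EVERY injective layout:

* **`partitionMinor_hit_of_corank_le`** — for `h ≥ 4`, `c² ≤ h`, `2^{c²} ≤ 2h` and `r + c ≥ 2^h`, every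
  injective layout of size `r` is hit in `SmallCircuits ℂ (h+h) 9`;
* **`partitionMinor_hit_of_corank_le_eventually`** — for every `c` there is `h₀ = max 4 2^{c²}` beyond
  which all partition minors of co-rank `≤ c` are hit.

val-np-p6 g6 had co-rank `≤ 3` (`FrobeniusDoor.partitionMinor_hit_of_corank_le_three`, p570489, via
pairwise-isomorphic lower sets and the same-pattern Frobenius door); the cone split needs neither an
isomorphism nor a table. WHAT THIS IS NOT: a bounded-co-rank class only; nothing on the middle range of
`r`, on crux stmt-ValiantsHypothesis-14610 or on `VP ≠ VNP`.
-/

set_option linter.dupNamespace false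

namespace Summit.ValiantsHypothesis.ValiantsHypothesis.Theorems.BarrierLever.ConeSplit

open Finset MvPolynomial
open Literature.Barriers.ValiantsHypothesis Literature.Computability.AlgebraicComplexity
open Summit.ValiantsHypothesis.ValiantsHypothesis.Theorems.BarrierLever.DownCompression
  (exists_witness_of_lowerSets size_le_pow)
open Summit.ValiantsHypothesis.ValiantsHypothesis.Theorems.BarrierLever.AdditiveDoor
  (truncation_spec degree_partitionExpo_le)

noncomputable section

variable {h : ℕ}

/-! ## 1. Lower sets of bounded co-rank have large cones -/

/-- **Cones of a lower set of co-rank `≤ c`.** If the range of the injective family `v` is a lower set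
missing at most `c` of the `2^h` subsets (`2^h ≤ r + c`) and `c² ≤ h`, some `A ⊆ [h]` with `|A| = h − c²`
lies inside every missing set (each missing set has fewer than `c` elements outside it, since all its
supersets are missing too). -/
theorem exists_cone_of_corank_le (c : ℕ) {r : ℕ} (hc : c * c ≤ h) (v : Fin r → Finset (Fin h))
    (hv : Function.Injective v) (hlow : IsLowerSet (Set.range v)) (hr : 2 ^ h ≤ r + c) :
    ∃ A : Finset (Fin h), A.card = h - c * c ∧ ∀ S : Finset (Fin h), S ∉ Set.range v → A ⊆ S := by
  classical
  -- the missing sets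
  set M : Finset (Finset (Fin h)) := Finset.univ.filter (fun S => S ∉ Set.range v) with hM
  have hMmem : ∀ S, S ∈ M ↔ S ∉ Set.range v := fun S => by simp [hM]
  have hMcard : M.card ≤ c := by
    have h1 : (Finset.univ.image v).card = r := by
      rw [Finset.card_image_of_injective _ hv, Finset.card_univ, Fintype.card_fin]
    have h2 : M = Finset.univ \ Finset.univ.image v := by
      ext S
      rw [hMmem, Finset.mem_sdiff, Finset.mem_image]
      simp only [Finset.mem_univ, true_and, Set.mem_range, not_exists]
    have h3 : M.card = 2 ^ h - r := by
      rw [h2, Finset.card_univ_sdiff, h1, Fintype.card_finset, Fintype.card_fin]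
    omega
  -- every complement of a missing set is small: its supersets are all missing
  have hcompl : ∀ m ∈ M, (Finset.univ \ m).card < c := by
    intro m hm
    have hmiss : m ∉ Set.range v := (hMmem m).mp hm
    have hmaps : ∀ D ∈ (Finset.univ \ m).powerset, m ∪ D ∈ M := by
      intro D _
      rw [hMmem]
      intro hmem
      exact hmiss (hlow (Finset.subset_union_left : m ≤ m ∪ D) hmem)
    have hinj : Set.InjOn (fun D => m ∪ D) ((Finset.univ \ m).powerset : Set (Finset (Fin h))) := by
      intro D hD D' hD' hDD'
      have hD1 : D ⊆ Finset.univ \ m := Finset.mem_powerset.mp hD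
      have hD1' : D' ⊆ Finset.univ \ m := Finset.mem_powerset.mp hD'
      have e1 : (m ∪ D) \ m = D := by
        rw [Finset.union_sdiff_left]
        exact Finset.sdiff_eq_self_of_disjoint
          (Finset.disjoint_of_subset_left hD1 Finset.sdiff_disjoint)
      have e2 : (m ∪ D') \ m = D' := by
        rw [Finset.union_sdiff_left]
        exact Finset.sdiff_eq_self_of_disjoint
          (Finset.disjoint_of_subset_left hD1' Finset.sdiff_disjoint)
      have := congrArg (fun S => S \ m) hDD'
      simp only [e1, e2] at this
      exact this
    have hle : 2 ^ (Finset.univ \ m).card ≤ M.card := by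
      rw [← Finset.card_powerset]
      exact Finset.card_le_card_of_injOn _ hmaps hinj
    have hlt : (Finset.univ \ m).card < 2 ^ (Finset.univ \ m).card := Nat.lt_two_pow_self
    omega
  -- the union of the complements, and its complement
  set Ubar : Finset (Fin h) := M.biUnion (fun m => Finset.univ \ m) with hU
  have hUcard : Ubar.card ≤ c * c := by
    calc Ubar.card ≤ ∑ m ∈ M, (Finset.univ \ m).card := Finset.card_biUnion_le
      _ ≤ ∑ _m ∈ M, c := Finset.sum_le_sum fun m hm => (hcompl m hm).le
      _ = M.card * c := by rw [Finset.sum_const, smul_eq_mul]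
      _ ≤ c * c := Nat.mul_le_mul_right _ hMcard
  have hsub : ∀ S : Finset (Fin h), S ∉ Set.range v → Finset.univ \ Ubar ⊆ S := by
    intro S hS a ha
    by_contra haS
    have hSM : S ∈ M := (hMmem S).mpr hS
    have haU : a ∈ Ubar := by
      rw [hU, Finset.mem_biUnion]
      exact ⟨S, hSM, Finset.mem_sdiff.mpr ⟨Finset.mem_univ _, haS⟩⟩
    exact (Finset.mem_sdiff.mp ha).2 haU
  have hcard0 : h - c * c ≤ (Finset.univ \ Ubar).card := by
    rw [Finset.card_univ_sdiff, Fintype.card_fin]; omega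
  obtain ⟨A, hAsub, hAcard⟩ := Finset.exists_subset_card_eq hcard0
  exact ⟨A, hAcard, fun S hS => hAsub.trans (hsub S hS)⟩

/-- **Lower-set pairs of co-rank `≤ c`** (`h ≥ 4`, `c² ≤ h`, `2^{c²} ≤ 2h`): hit in `SmallCircuits ℂ (h+h) 4`
by the cone split. -/
theorem partitionMinor_hit_lowerSets_of_corank_le (c : ℕ) {r : ℕ} (hh : 4 ≤ h) (hc : c * c ≤ h)
    (hpow : 2 ^ (c * c) ≤ h + h) (hr : 2 ^ h ≤ r + c) (v w : Fin r → Finset (Fin h))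
    (hv : Function.Injective v) (hw : Function.Injective w)
    (hlv : IsLowerSet (Set.range v)) (hlw : IsLowerSet (Set.range w)) :
    ∃ f ∈ SmallCircuits ℂ (h + h) 4,
      (Matrix.of fun i j : Fin r => MvPolynomial.coeff
        (∑ a ∈ v i, Finsupp.single (Fin.castAdd h a) 1 +
          ∑ c ∈ w j, Finsupp.single (Fin.natAdd h c) 1) f).det ≠ 0 := by
  obtain ⟨A, hAcard, hA⟩ := exists_cone_of_corank_le c hc v hv hlv hr
  obtain ⟨B, hBcard, hB⟩ := exists_cone_of_corank_le c hc w hw hlw hr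
  refine partitionMinor_hit_of_cones hh v w hv hw A B (by rw [hAcard, hBcard]) ?_ hA hB
  rw [hAcard, Nat.sub_sub_self hc]
  exact hpow

/-! ## 2. All minors of co-rank `≤ c` -/

/-- **ALL MINORS OF CO-RANK ≤ c.** For `h ≥ 4`, `c² ≤ h` and `2^{c²} ≤ 2h`, every injective layout with
`r + c ≥ 2^h` rows is hit in `SmallCircuits ℂ (h+h) 9` (lower-set reduction of val-np-p1 g12 + the cone
split + truncation). -/
theorem partitionMinor_hit_of_corank_le (c : ℕ) {r : ℕ} (hh : 4 ≤ h) (hc : c * c ≤ h)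
    (hpow : 2 ^ (c * c) ≤ h + h) (hr : 2 ^ h ≤ r + c) (u w : Fin r → Finset (Fin h))
    (hu : Function.Injective u) (hw : Function.Injective w) :
    ∃ f ∈ SmallCircuits ℂ (h + h) 9,
      (Matrix.of fun i j : Fin r => MvPolynomial.coeff
        (∑ a ∈ u i, Finsupp.single (Fin.castAdd h a) 1 +
          ∑ c ∈ w j, Finsupp.single (Fin.natAdd h c) 1) f).det ≠ 0 := by
  have hyp : ∀ v w' : Fin r → Finset (Fin h), Function.Injective v → Function.Injective w' →
      IsLowerSet (Set.range v) → IsLowerSet (Set.range w') →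
      ∃ f : MvPolynomial (Fin (h + h)) ℂ, complexity f ≤ (h + h) ^ 5 ∧ f.totalDegree ≤ h + h ∧
        (Matrix.of fun i j : Fin r => MvPolynomial.coeff
          (∑ a ∈ v i, Finsupp.single (Fin.castAdd h a) 1 +
            ∑ c ∈ w' j, Finsupp.single (Fin.natAdd h c) 1) f).det ≠ 0 := by
    intro v w' hv hw' hlv hlw'
    obtain ⟨f, ⟨hfd, hfs⟩, hf⟩ :=
      partitionMinor_hit_lowerSets_of_corank_le c hh hc hpow hr v w' hv hw' hlv hlw'
    exact ⟨f, hfs.trans (Nat.pow_le_pow_right (by omega) (by norm_num)), hfd, hf⟩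
  obtain ⟨g, hgs, hgd, hg⟩ := exists_witness_of_lowerSets ((h + h) ^ 5) (h + h) hyp u w hu hw
  obtain ⟨hdeg, hcoeff, hsize⟩ := truncation_spec g (h + h)
  refine ⟨∑ k ∈ Finset.range (h + h + 1), homogeneousComponent k g, ⟨hdeg, ?_⟩, ?_⟩
  · calc complexity (∑ k ∈ Finset.range (h + h + 1), homogeneousComponent k g)
        ≤ (h + h + 2) ^ 2 * complexity g + (h + h + 1) := hsize
      _ ≤ (h + h + 2) ^ 2 * ((h + h) ^ 5 + 6 * h) + (h + h + 1) := by gcongr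
      _ ≤ (h + h) ^ (5 + 4) := size_le_pow h 5 hh
  · have hmat : (Matrix.of fun i j : Fin r => MvPolynomial.coeff
        (∑ a ∈ u i, Finsupp.single (Fin.castAdd h a) 1 +
          ∑ c ∈ w j, Finsupp.single (Fin.natAdd h c) 1)
        (∑ k ∈ Finset.range (h + h + 1), homogeneousComponent k g)) =
        Matrix.of fun i j : Fin r => MvPolynomial.coeff
          (∑ a ∈ u i, Finsupp.single (Fin.castAdd h a) 1 +
            ∑ c ∈ w j, Finsupp.single (Fin.natAdd h c) 1) g := by
      ext i j
      rw [Matrix.of_apply, Matrix.of_apply, hcoeff _ (degree_partitionExpo_le _ _)]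
    rw [hmat]
    exact hg

/-- **Eventually in `h`, every constant co-rank is covered**: for every `c` there is `h₀` (namely
`max 4 (2^{c²})`) beyond which every injective layout with `r + c ≥ 2^h` is hit in `SmallCircuits ℂ (h+h) 9`. -/
theorem partitionMinor_hit_of_corank_le_eventually (c : ℕ) :
    ∃ h₀ : ℕ, ∀ h : ℕ, h₀ ≤ h → ∀ (r : ℕ) (u w : Fin r → Finset (Fin h)),
      Function.Injective u → Function.Injective w → 2 ^ h ≤ r + c →
        ∃ f ∈ SmallCircuits ℂ (h + h) 9,
          (Matrix.of fun i j : Fin r => MvPolynomial.coeff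
            (∑ a ∈ u i, Finsupp.single (Fin.castAdd h a) 1 +
              ∑ c ∈ w j, Finsupp.single (Fin.natAdd h c) 1) f).det ≠ 0 := by
  refine ⟨max 4 (2 ^ (c * c)), fun h hh r u w hu hw hr => ?_⟩
  have hh4 : 4 ≤ h := le_trans (le_max_left _ _) hh
  have hpow : 2 ^ (c * c) ≤ h := le_trans (le_max_right _ _) hh
  have hcc : c * c ≤ h := le_trans (Nat.lt_two_pow_self).le hpow
  exact partitionMinor_hit_of_corank_le c hh4 hcc (hpow.trans (Nat.le_add_right _ _)) hr u w hu hw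

end

end Summit.ValiantsHypothesis.ValiantsHypothesis.Theorems.BarrierLever.ConeSplit
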